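/-
Fleet lead `ym-wcr-19609-p1` (seat prover-ym-wcr-19609-p1-g2-0), route `WeakCouplingRates`, crux `BulkDominatesColdBoxW`
(stmt-QuantumFields-19609), line `dlr-chessboard` (v6): registered stub `stub_flatCovExpansion` ⇐ the sibling crux's absolute Dirichlet domination.
-/
import Summits.QuantumFields.YangMills.Theorems.WeakCouplingRatesBulkDominatesColdBoxWDirKernelTwoPoint
import Summits.QuantumFields.YangMills.Theorems.WeakCouplingRatesColdBoxDirichletWick

/-!
# Crux `BulkDominatesColdBoxW`, stub `stub_flatCovExpansion` ⇐ the ABSOLUTE Dirichlet domination of crux `ColdBoxTwoPointFloorW`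

The v6 sub-stub `stub_flatCovExpansion : ∃ θ₂ > 0, ∀ 0 < θ ≤ θ₂, FlatCovExpansion (θ/20) θ` of the line `dlr-chessboard`
(`FlatCovExpansion A θ`: `|β²·boxPlaqCov β ⌈β^θ⌉ ⌈β^A⌉ − (3/2)·C_D(p_c, p_c + ⌈β^A⌉e₀)²| ≤ β^{−θ/2}` eventually) is the sibling crux's one-scale
expansion of the cold-wall box in its natural ABSOLUTE Dirichlet form (the hypothesis `habs` of `stub_boxGaussianDomination_of_abs`,
`Theorems/WeakCouplingRatesColdBoxStubOfAbs.lean`; = the lead's v7 `stub_boxDirichletDominationAbs` of 19608):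
`∃ θ₀ > 0, ∀ 0 < θ ≤ θ₀, ∃ κ > 8θ, ∃ β₀, ∀ β ≥ β₀, ∀ T ≤ ⌈β^θ⌉, |β²·boxPlaqCov β ⌈β^θ⌉ T − ¾·boxDirCircSqCov ⌈β^θ⌉ T| ≤ β^{−κ}`.
Bridge (`flatCovExpansion_of_domAbs`): `¾·boxDirCircSqCov = (3/2)·Π_D²` (Wick, `boxDirCircSqCov_eq_two_mul_sq`), `Π_D(H,T) = C_D(p_c, p_c+Te₀)`
(`boxDirProjKernel_centre_eq`), `T = ⌈β^{θ/20}⌉ ≤ ⌈β^θ⌉` and `β^{−κ} ≤ β^{−θ/2}` for `β ≥ 1` (`κ > 8θ > θ/2`).  So ONE proof of the absolute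
domination (19608's assembly R4, flat) lands `stub_boxGaussianDomination` there AND `stub_flatCovExpansion` here.
No new definition; standard axioms.  NOT a claim about the mass gap.
-/

set_option autoImplicit false

noncomputable section

open Literature.MathematicalPhysics.QuantumLattice

namespace Summit.QuantumFields.YangMills.Theorems.WeakCouplingRates

/-- **`stub_flatCovExpansion` ⇐ absolute Dirichlet domination** (hypothesis in the exact form of `stub_boxGaussianDomination_of_abs`). -/
theorem flatCovExpansion_of_domAbs
    (habs : ∃ θ₀ : ℝ, 0 < θ₀ ∧ ∀ θ : ℝ, 0 < θ → θ ≤ θ₀ → ∃ κ : ℝ, 8 * θ < κ ∧ ∃ β₀ : ℝ, ∀ β : ℝ, β₀ ≤ β →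
      ∀ T : ℕ, T ≤ ⌈β ^ θ⌉₊ →
        |β ^ 2 * boxPlaqCov (fundamentalRep (Fin 2)) β ⌈β ^ θ⌉₊ T - 3 / 4 * boxDirCircSqCov ⌈β ^ θ⌉₊ T| ≤ β ^ (-κ)) :
    ∃ θ₂ : ℝ, 0 < θ₂ ∧ ∀ θ : ℝ, 0 < θ → θ ≤ θ₂ → FlatCovExpansion (θ / 20) θ := by
  obtain ⟨θ₀, hθ₀, habs⟩ := habs
  refine ⟨θ₀, hθ₀, fun θ hθ hθle => ?_⟩
  obtain ⟨κ, hκ, β₁, h₁⟩ := habs θ hθ hθle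
  unfold FlatCovExpansion
  refine ⟨max β₁ 1, fun β hβ => ?_⟩
  have hβ₁ : β₁ ≤ β := le_trans (le_max_left _ _) hβ
  have hβ1 : (1 : ℝ) ≤ β := le_trans (le_max_right _ _) hβ
  -- `T = ⌈β^{θ/20}⌉ ≤ ⌈β^θ⌉`
  have hT : ⌈β ^ (θ / 20)⌉₊ ≤ ⌈β ^ θ⌉₊ :=
    Nat.ceil_mono (Real.rpow_le_rpow_of_exponent_le hβ1 (by linarith))
  have h := h₁ β hβ₁ ⌈β ^ (θ / 20)⌉₊ hT
  -- `¾·boxDirCircSqCov = (3/2)·C_D²`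
  rw [boxDirCircSqCov_eq_two_mul_sq, ← boxDirProjKernel_centre_eq] at h
  set K : ℝ := boxDirProjKernel ⌈β ^ θ⌉₊ (boxCentre ⌈β ^ θ⌉₊, 1, 2)
    (boxCentre ⌈β ^ θ⌉₊ + Pi.single 0 (⌈β ^ (θ / 20)⌉₊ : ℤ), 1, 2) with hK
  have h34 : (3 : ℝ) / 4 * (2 * K ^ 2) = 3 / 2 * K ^ 2 := by ring
  rw [h34] at h
  have hpow : β ^ (-κ) ≤ β ^ (-(θ / 2)) := Real.rpow_le_rpow_of_exponent_le hβ1 (by linarith)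
  exact h.trans hpow

end Summit.QuantumFields.YangMills.Theorems.WeakCouplingRates

end
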